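import Summits.AnomalousDissipation.AnomalousDissipation.Theorems.SawtoothPulseCascadeK1LocalisedCascadeFibreChirp
import Literature.Analysis.Fourier.TorusGridAliasingTail

/-!
# K1loc, line `Spectral` / thin start — helper: DESCENT OF THE FIBRE COMPONENTS TO THE CIRCLE («exact 1-D Egorov», 1-D form)

Helper file of the prover lane on the crux `K1LocalisedCascade` (stmt-AnomalousDissipation-19491), route
`SawtoothPulseCascade` (S-B/S-C assembly seat; Fourier bookkeeping for the S-D channel functionals).  Continuation of
`…FibreChirp`.  The fibre component `A^i_m v(x) = ∫ e_{−m}(s)v(x + s eᵢ)ds` is `e_m`-EQUIVARIANT along `eᵢ`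
(`twistedAxisAvg_add_single`: `A^i_m v(x + t eᵢ) = e_m(t)·A^i_m v(x)`), hence `A^i_m v(x) = e_m(xᵢ)·A^i_m v(x̂)` with `x̂ = x`
off `i` and `x̂ᵢ = 0` (`twistedAxisAvg_eq_fourier_mul_update`).  On `𝕋²` this descends the chirped fibre components of
`…FibreChirp` to the circle: for continuous `b : 𝕋² → ℂ`, `G : 𝕋 → ℂ`,
**`𝓕(x ↦ G(x₀)·A¹_m b(x))(k) = [k₁ = m]·𝓕_𝕋(z ↦ G(z)·β_m(z))(k₀)`**, `β_m(z) = ∫ e_{−m}(s) b(z, s) ds` the `m`-th vertical Fourier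
coefficient of `b` on the vertical line `{x₀ = z}` (`mFourierCoeff_chirp_fibre_eq`), and the slab sum becomes a sum over `ℤ`
(`tsum_slab_chirp_fibre_eq`).  With `…FibreChirp.tsum_horizontalWeight_vstep_eq_fibre_chirp` this is the fully ONE-DIMENSIONAL
form of the cascade's V half-step: for `a' = b ∘ shearMap 1 0 ψ` and any bounded weight `w` of the horizontal frequency,
**`Σ' k, w(k₀)‖𝓕a'(k)‖² = Σ' m, Σ' n, w(n)·‖𝓕_𝕋(z ↦ e_{−m}(ψ(z))·β_m(z))(n)‖²`** (`tsum_horizontalWeight_vstep_eq_circle`): the low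
band / strip / saturated horizontal functional after a V half-step is a double series of CIRCLE Fourier coefficients of the
chirped vertical coefficient functions `e^{−2πi m ψ(z)}β_m(z)` — the object of the 1-D estimates of both crux ideas on the S-D
target (`renormalised-escape-weight` (b)–(e), `averaged-comb-ledger` (ii) `CombKernelFormula`); §4 is the twin for the H half-step and
VERTICAL weights (horizontal fibres `k₀ = m`, horizontal coefficient functions `α_m(z) = ∫ e_{−m}(s) a(s, z) ds`).  No definitions; no estimate.
[cite: Grafakos2014, Prop. 3.1.2 (5) and Prop. 3.2.7 (3)] [cite: Boyd2001, §4.5 Theorem 19 (4.44) (shift rule)] [problem: turb]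
-/

-- `Summit.<Summit>.<Problem>`: single-conjunct summit, the duplicate namespace segment is deliberate.
set_option linter.dupNamespace false

noncomputable section

namespace Summit.AnomalousDissipation.AnomalousDissipation.Theorems.SawtoothPulseCascade.K1Start

open MeasureTheory Set Filter Topology UnitAddTorus Function
open Literature.Analysis.FunctionSpaces Literature.Analysis.FunctionSpaces.Torus

variable {d : Type*} [Fintype d] [DecidableEq d]

/-! ## §1 Equivariance of the fibre component along its axis -/

omit [Fintype d] [DecidableEq d] in
/-- `e_{−m}(−t) = e_m(t)`. [cite: Grafakos2014, Prop. 3.1.2 (5)] -/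
theorem fourier_neg_neg (m : ℤ) (t : UnitAddCircle) : (fourier (-m) (-t) : ℂ) = fourier m t := by
  rw [fourier_apply, fourier_apply, neg_zsmul, zsmul_neg, neg_neg]

omit [Fintype d] in
/-- **The fibre component is `e_m`-equivariant along its axis**: `A^i_m v(x + t eᵢ) = e_m(t)·A^i_m v(x)`.
[cite: Grafakos2014, Prop. 3.1.2 (5)] -/
theorem twistedAxisAvg_add_single (v : UnitAddTorus d → ℂ) (i : d) (m : ℤ) (x : UnitAddTorus d) (t : UnitAddCircle) :
    ∫ s : UnitAddCircle, (fourier (-m) s : ℂ) • v (x + Pi.single i t + Pi.single i s) =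
      fourier m t * ∫ s : UnitAddCircle, (fourier (-m) s : ℂ) • v (x + Pi.single i s) := by
  set F : UnitAddCircle → ℂ := fun s => (fourier (-m) (s + -t) : ℂ) • v (x + Pi.single i s) with hF
  have h1 : ∫ s : UnitAddCircle, (fourier (-m) s : ℂ) • v (x + Pi.single i t + Pi.single i s) =
      ∫ s : UnitAddCircle, F (s + t) := by
    refine integral_congr_ae (Eventually.of_forall fun s => ?_)
    simp only [hF, add_neg_cancel_right]
    rw [add_assoc, ← Pi.single_add, add_comm t s]
  rw [h1, integral_add_right_eq_self (μ := (volume : Measure UnitAddCircle)) F t]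
  simp only [hF]
  simp_rw [fourier_apply_add (-m) _ (-t), fourier_neg_neg, mul_smul, integral_smul, smul_eq_mul]

omit [Fintype d] in
/-- A point of the torus splits as its `i`-th coordinate plus the rest. [folklore] -/
theorem update_add_single_eq (x : UnitAddTorus d) (i : d) : Function.update x i 0 + Pi.single i (x i) = x := by
  funext l
  by_cases hl : l = i
  · subst hl; simp
  · simp [Pi.single_eq_of_ne hl, Function.update_of_ne hl]

omit [Fintype d] in
/-- **Descent of the fibre component**: `A^i_m v(x) = e_m(xᵢ)·A^i_m v(x̂)`, `x̂ = update x i 0`.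
[cite: Grafakos2014, Prop. 3.1.2 (5)] -/
theorem twistedAxisAvg_eq_fourier_mul_update (v : UnitAddTorus d → ℂ) (i : d) (m : ℤ) (x : UnitAddTorus d) :
    ∫ s : UnitAddCircle, (fourier (-m) s : ℂ) • v (x + Pi.single i s) =
      fourier m (x i) * ∫ s : UnitAddCircle, (fourier (-m) s : ℂ) • v (Function.update x i 0 + Pi.single i s) := by
  rw [← twistedAxisAvg_add_single v i m (Function.update x i 0) (x i), update_add_single_eq]

/-! ## §2 On `𝕋²`: the chirped vertical fibre component is a function of `x₀` times `e_m(x₁)` -/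

/-- The vertical line through `(z, 0)`: `update x 1 0 + s e₁ = (x₀, s)`, written with `![·, ·]`. [folklore] -/
theorem update_add_single_fin_two (x : UnitAddTorus (Fin 2)) (s : UnitAddCircle) :
    Function.update x 1 0 + Pi.single (1 : Fin 2) s = (![x 0, s] : UnitAddTorus (Fin 2)) := by
  funext l
  fin_cases l <;> simp

/-- **The vertical coefficient function is continuous**: `z ↦ β_m(z) = ∫ e_{−m}(s) b(z, s) ds` is continuous for continuous `b`.
[folklore] -/
theorem continuous_verticalCoeff {b : UnitAddTorus (Fin 2) → ℂ} (hb : Continuous b) (m : ℤ) :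
    Continuous fun z : UnitAddCircle => ∫ s : UnitAddCircle, (fourier (-m) s : ℂ) • b (![z, s] : UnitAddTorus (Fin 2)) := by
  have hA := continuous_twistedAxisAvg hb (1 : Fin 2) m
  have hι : Continuous fun z : UnitAddCircle => (![z, 0] : UnitAddTorus (Fin 2)) := by
    refine continuous_pi fun l => ?_
    fin_cases l
    · exact continuous_id
    · exact continuous_const
  have h := hA.comp hι
  refine h.congr fun z => ?_
  simp only [Function.comp_apply]
  refine integral_congr_ae (Eventually.of_forall fun s => ?_)
  show (fourier (-m) s : ℂ) • b ((![z, 0] : UnitAddTorus (Fin 2)) + Pi.single (1 : Fin 2) s) =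
    (fourier (-m) s : ℂ) • b (![z, s] : UnitAddTorus (Fin 2))
  congr 2
  funext l
  fin_cases l <;> simp

/-- **Descent to the circle, mode by mode**: for continuous `b : 𝕋² → ℂ` and `G : 𝕋 → ℂ`,
`𝓕(x ↦ G(x₀)·A¹_m b(x))(k) = [k₁ = m]·𝓕_𝕋(z ↦ G(z)·β_m(z))(k₀)`, `β_m(z) = ∫ e_{−m}(s) b(z, s) ds`.
[cite: Grafakos2014, Prop. 3.1.2 (5)] [cite: Boyd2001, §4.5 Theorem 19 (4.44)] -/
theorem mFourierCoeff_chirp_fibre_eq {b : UnitAddTorus (Fin 2) → ℂ} (hb : Continuous b) {G : UnitAddCircle → ℂ}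
    (hG : Continuous G) (m : ℤ) (k : Fin 2 → ℤ) :
    mFourierCoeff (fun x : UnitAddTorus (Fin 2) => G (x 0) *
        ∫ s : UnitAddCircle, (fourier (-m) s : ℂ) • b (x + Pi.single (1 : Fin 2) s)) k =
      if k 1 = m then fourierCoeff (fun z : UnitAddCircle => G z *
        ∫ s : UnitAddCircle, (fourier (-m) s : ℂ) • b (![z, s] : UnitAddTorus (Fin 2))) (k 0) else 0 := by
  -- the integrand as `e_{m e₁}(x) · H(x₀)`
  set H : UnitAddCircle → ℂ := fun z => G z * ∫ s : UnitAddCircle, (fourier (-m) s : ℂ) • b (![z, s] : UnitAddTorus (Fin 2))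
    with hH
  have hHc : Continuous H := hG.mul (continuous_verticalCoeff hb m)
  have hfun : (fun x : UnitAddTorus (Fin 2) => G (x 0) * ∫ s : UnitAddCircle, (fourier (-m) s : ℂ) • b (x + Pi.single (1 : Fin 2) s)) =
      fun x => mFourier (Pi.single (1 : Fin 2) m) x * H (x 0) := by
    funext x
    rw [twistedAxisAvg_eq_fourier_mul_update b 1 m x, Torus.mFourier_single]
    simp_rw [update_add_single_fin_two]
    simp only [hH]
    ring
  rw [hfun, Literature.Analysis.Fourier.mFourierCoeff_mFourier_mul, mFourierCoeff_comp_eval hHc (0 : Fin 2)]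
  have hiff : (∀ l : Fin 2, l ≠ 0 → (k - Pi.single (1 : Fin 2) m : Fin 2 → ℤ) l = 0) ↔ k 1 = m := by
    constructor
    · intro h
      have h1 := h 1 (by decide)
      simp only [Pi.sub_apply, Pi.single_eq_same] at h1
      exact sub_eq_zero.mp h1
    · intro h l hl
      have hl1 : l = 1 := by fin_cases l <;> simp_all
      subst hl1
      simp [h]
  by_cases hk : k 1 = m
  · rw [if_pos (hiff.mpr hk), if_pos hk]
    simp
  · rw [if_neg (fun h => hk (hiff.mp h)), if_neg hk]

/-- **The slab sum becomes a sum over `ℤ`**: for continuous `b`, `G` and any weight `W` on `ℤ²`,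
`Σ' k, [k₁ = m]·(W(k)·‖𝓕(G(x₀)·A¹_m b)(k)‖²) = Σ' n, W(n, m)·‖𝓕_𝕋(G·β_m)(n)‖²`.
[cite: Grafakos2014, Prop. 3.2.7 (3)] -/
theorem tsum_slab_chirp_fibre_eq {b : UnitAddTorus (Fin 2) → ℂ} (hb : Continuous b) {G : UnitAddCircle → ℂ}
    (hG : Continuous G) (m : ℤ) (W : (Fin 2 → ℤ) → ℝ) :
    ∑' k : Fin 2 → ℤ, (if k 1 = m then (1 : ℝ) else 0) * (W k *
        ‖mFourierCoeff (fun x : UnitAddTorus (Fin 2) => G (x 0) *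
          ∫ s : UnitAddCircle, (fourier (-m) s : ℂ) • b (x + Pi.single (1 : Fin 2) s)) k‖ ^ 2) =
      ∑' n : ℤ, W ![n, m] * ‖fourierCoeff (fun z : UnitAddCircle => G z *
        ∫ s : UnitAddCircle, (fourier (-m) s : ℂ) • b (![z, s] : UnitAddTorus (Fin 2))) n‖ ^ 2 := by
  set g : ℤ → (Fin 2 → ℤ) := fun n => ![n, m] with hg
  have hginj : Function.Injective g := fun n n' h => by
    have := congrFun h 0
    simpa [hg] using this
  set f : (Fin 2 → ℤ) → ℝ := fun k => (if k 1 = m then (1 : ℝ) else 0) * (W k *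
    ‖mFourierCoeff (fun x : UnitAddTorus (Fin 2) => G (x 0) *
      ∫ s : UnitAddCircle, (fourier (-m) s : ℂ) • b (x + Pi.single (1 : Fin 2) s)) k‖ ^ 2) with hf
  have hsupp : Function.support f ⊆ Set.range g := by
    intro k hk
    rw [Function.mem_support] at hk
    have hk1 : k 1 = m := by
      by_contra h
      exact hk (by rw [hf]; simp only [if_neg h, zero_mul])
    refine ⟨k 0, ?_⟩
    funext l
    fin_cases l
    · simp [hg]
    · simp [hg, hk1]
  rw [show (∑' k : Fin 2 → ℤ, (if k 1 = m then (1 : ℝ) else 0) * (W k *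
        ‖mFourierCoeff (fun x : UnitAddTorus (Fin 2) => G (x 0) *
          ∫ s : UnitAddCircle, (fourier (-m) s : ℂ) • b (x + Pi.single (1 : Fin 2) s)) k‖ ^ 2)) = ∑' k, f k from rfl,
    ← hginj.tsum_eq hsupp]
  refine tsum_congr fun n => ?_
  simp only [hf, hg, mFourierCoeff_chirp_fibre_eq hb hG m]
  simp

/-! ## §3 The cascade's V half-step in 1-D form -/

/-- **The V half-step, fully one-dimensional**: for `a' = b ∘ shearMap 1 0 ψ` (continuous real `b`, any profile `ψ`) and a
bounded weight `w` of the horizontal frequency,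
`Σ' k, w(k₀)‖𝓕a'(k)‖² = Σ' m, Σ' n, w(n)·‖𝓕_𝕋(z ↦ e_{−m}(ψ(z))·β_m(z))(n)‖²`, `β_m(z) = ∫ e_{−m}(s) b(z, s) ds`:
every horizontal spectral functional after the V half-step is a double series of circle Fourier coefficients of the CHIRPED
vertical coefficient functions. [cite: Grafakos2014, Prop. 3.1.2 (5) and Prop. 3.2.7 (3)] [cite: Boyd2001, §4.5 Theorem 19 (4.44)] -/
theorem tsum_horizontalWeight_vstep_eq_circle {b a' : UnitAddTorus (Fin 2) → ℝ} (hb : Continuous b) (ψ : ShearProfile)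
    (ha' : a' = b ∘ shearMap 1 0 ψ) {w : ℤ → ℝ} {C : ℝ} (hw : ∀ m, |w m| ≤ C) :
    ∑' k : Fin 2 → ℤ, w (k 0) * ‖mFourierCoeff (fun x => (a' x : ℂ)) k‖ ^ 2 =
      ∑' m : ℤ, ∑' n : ℤ, w n * ‖fourierCoeff (fun z : UnitAddCircle => twist ψ m z *
        ∫ s : UnitAddCircle, (fourier (-m) s : ℂ) • ((b (![z, s] : UnitAddTorus (Fin 2)) : ℝ) : ℂ)) n‖ ^ 2 := by
  rw [tsum_horizontalWeight_vstep_eq_fibre_chirp hb ψ ha' hw]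
  refine tsum_congr fun m => ?_
  have hbc : Continuous (fun x : UnitAddTorus (Fin 2) => (b x : ℂ)) := Complex.continuous_ofReal.comp hb
  have h := tsum_slab_chirp_fibre_eq hbc (continuous_twist ψ m) m (fun k => w (k 0))
  simp only [Matrix.cons_val_zero] at h
  exact h

/-! ## §4 The twin: horizontal fibres and the cascade's H half-step in 1-D form -/

/-- The horizontal line through `(0, z)`: `update x 0 0 + s e₀ = (s, x₁)`. [folklore] -/
theorem update_add_single_fin_two' (x : UnitAddTorus (Fin 2)) (s : UnitAddCircle) :
    Function.update x 0 0 + Pi.single (0 : Fin 2) s = (![s, x 1] : UnitAddTorus (Fin 2)) := by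
  funext l
  fin_cases l <;> simp

/-- **The horizontal coefficient function is continuous**: `z ↦ α_m(z) = ∫ e_{−m}(s) b(s, z) ds` is continuous for continuous `b`.
[folklore] -/
theorem continuous_horizontalCoeff {b : UnitAddTorus (Fin 2) → ℂ} (hb : Continuous b) (m : ℤ) :
    Continuous fun z : UnitAddCircle => ∫ s : UnitAddCircle, (fourier (-m) s : ℂ) • b (![s, z] : UnitAddTorus (Fin 2)) := by
  have hA := continuous_twistedAxisAvg hb (0 : Fin 2) m
  have hι : Continuous fun z : UnitAddCircle => (![0, z] : UnitAddTorus (Fin 2)) := by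
    refine continuous_pi fun l => ?_
    fin_cases l
    · exact continuous_const
    · exact continuous_id
  have h := hA.comp hι
  refine h.congr fun z => ?_
  simp only [Function.comp_apply]
  refine integral_congr_ae (Eventually.of_forall fun s => ?_)
  show (fourier (-m) s : ℂ) • b ((![0, z] : UnitAddTorus (Fin 2)) + Pi.single (0 : Fin 2) s) =
    (fourier (-m) s : ℂ) • b (![s, z] : UnitAddTorus (Fin 2))
  congr 2
  funext l
  fin_cases l <;> simp

/-- **Descent to the circle, horizontal fibres**: for continuous `b : 𝕋² → ℂ` and `G : 𝕋 → ℂ`,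
`𝓕(x ↦ G(x₁)·A⁰_m b(x))(k) = [k₀ = m]·𝓕_𝕋(z ↦ G(z)·α_m(z))(k₁)`, `α_m(z) = ∫ e_{−m}(s) b(s, z) ds`.
[cite: Grafakos2014, Prop. 3.1.2 (5)] [cite: Boyd2001, §4.5 Theorem 19 (4.44)] -/
theorem mFourierCoeff_chirp_fibre_eq' {b : UnitAddTorus (Fin 2) → ℂ} (hb : Continuous b) {G : UnitAddCircle → ℂ}
    (hG : Continuous G) (m : ℤ) (k : Fin 2 → ℤ) :
    mFourierCoeff (fun x : UnitAddTorus (Fin 2) => G (x 1) *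
        ∫ s : UnitAddCircle, (fourier (-m) s : ℂ) • b (x + Pi.single (0 : Fin 2) s)) k =
      if k 0 = m then fourierCoeff (fun z : UnitAddCircle => G z *
        ∫ s : UnitAddCircle, (fourier (-m) s : ℂ) • b (![s, z] : UnitAddTorus (Fin 2))) (k 1) else 0 := by
  set H : UnitAddCircle → ℂ := fun z => G z * ∫ s : UnitAddCircle, (fourier (-m) s : ℂ) • b (![s, z] : UnitAddTorus (Fin 2))
    with hH
  have hHc : Continuous H := hG.mul (continuous_horizontalCoeff hb m)
  have hfun : (fun x : UnitAddTorus (Fin 2) => G (x 1) * ∫ s : UnitAddCircle, (fourier (-m) s : ℂ) • b (x + Pi.single (0 : Fin 2) s)) =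
      fun x => mFourier (Pi.single (0 : Fin 2) m) x * H (x 1) := by
    funext x
    rw [twistedAxisAvg_eq_fourier_mul_update b 0 m x, Torus.mFourier_single]
    simp_rw [update_add_single_fin_two']
    simp only [hH]
    ring
  rw [hfun, Literature.Analysis.Fourier.mFourierCoeff_mFourier_mul, mFourierCoeff_comp_eval hHc (1 : Fin 2)]
  have hiff : (∀ l : Fin 2, l ≠ 1 → (k - Pi.single (0 : Fin 2) m : Fin 2 → ℤ) l = 0) ↔ k 0 = m := by
    constructor
    · intro h
      have h1 := h 0 (by decide)
      simp only [Pi.sub_apply, Pi.single_eq_same] at h1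
      exact sub_eq_zero.mp h1
    · intro h l hl
      have hl1 : l = 0 := by fin_cases l <;> simp_all
      subst hl1
      simp [h]
  by_cases hk : k 0 = m
  · rw [if_pos (hiff.mpr hk), if_pos hk]
    simp
  · rw [if_neg (fun h => hk (hiff.mp h)), if_neg hk]

/-- **The slab sum becomes a sum over `ℤ`** (horizontal fibres): `Σ' k, [k₀ = m]·(W(k)·‖𝓕(G(x₁)·A⁰_m b)(k)‖²) = Σ' n, W(m, n)·‖𝓕_𝕋(G·α_m)(n)‖²`.
[cite: Grafakos2014, Prop. 3.2.7 (3)] -/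
theorem tsum_slab_chirp_fibre_eq' {b : UnitAddTorus (Fin 2) → ℂ} (hb : Continuous b) {G : UnitAddCircle → ℂ}
    (hG : Continuous G) (m : ℤ) (W : (Fin 2 → ℤ) → ℝ) :
    ∑' k : Fin 2 → ℤ, (if k 0 = m then (1 : ℝ) else 0) * (W k *
        ‖mFourierCoeff (fun x : UnitAddTorus (Fin 2) => G (x 1) *
          ∫ s : UnitAddCircle, (fourier (-m) s : ℂ) • b (x + Pi.single (0 : Fin 2) s)) k‖ ^ 2) =
      ∑' n : ℤ, W ![m, n] * ‖fourierCoeff (fun z : UnitAddCircle => G z *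
        ∫ s : UnitAddCircle, (fourier (-m) s : ℂ) • b (![s, z] : UnitAddTorus (Fin 2))) n‖ ^ 2 := by
  set g : ℤ → (Fin 2 → ℤ) := fun n => ![m, n] with hg
  have hginj : Function.Injective g := fun n n' h => by
    have := congrFun h 1
    simpa [hg] using this
  set f : (Fin 2 → ℤ) → ℝ := fun k => (if k 0 = m then (1 : ℝ) else 0) * (W k *
    ‖mFourierCoeff (fun x : UnitAddTorus (Fin 2) => G (x 1) *
      ∫ s : UnitAddCircle, (fourier (-m) s : ℂ) • b (x + Pi.single (0 : Fin 2) s)) k‖ ^ 2) with hf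
  have hsupp : Function.support f ⊆ Set.range g := by
    intro k hk
    rw [Function.mem_support] at hk
    have hk0 : k 0 = m := by
      by_contra h
      exact hk (by rw [hf]; simp only [if_neg h, zero_mul])
    refine ⟨k 1, ?_⟩
    funext l
    fin_cases l
    · simp [hg, hk0]
    · simp [hg]
  rw [show (∑' k : Fin 2 → ℤ, (if k 0 = m then (1 : ℝ) else 0) * (W k *
        ‖mFourierCoeff (fun x : UnitAddTorus (Fin 2) => G (x 1) *
          ∫ s : UnitAddCircle, (fourier (-m) s : ℂ) • b (x + Pi.single (0 : Fin 2) s)) k‖ ^ 2)) = ∑' k, f k from rfl,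
    ← hginj.tsum_eq hsupp]
  refine tsum_congr fun n => ?_
  simp only [hf, hg, mFourierCoeff_chirp_fibre_eq' hb hG m]
  simp

/-- **The H half-step, fully one-dimensional** (the twin): for `b = a ∘ shearMap 0 1 ψ` (continuous real `a`, any profile `ψ`)
and a bounded weight `w` of the VERTICAL frequency,
`Σ' k, w(k₁)‖𝓕b(k)‖² = Σ' m, Σ' n, w(n)·‖𝓕_𝕋(z ↦ e_{−m}(ψ(z))·α_m(z))(n)‖²`, `α_m(z) = ∫ e_{−m}(s) a(s, z) ds` the `m`-th horizontal
Fourier coefficient of `a` on the horizontal line `{x₁ = z}` — the object of the off-cone bookkeeping through the H half-step.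
[cite: Grafakos2014, Prop. 3.1.2 (5) and Prop. 3.2.7 (3)] [cite: Boyd2001, §4.5 Theorem 19 (4.44)] -/
theorem tsum_verticalWeight_hstep_eq_circle {a b : UnitAddTorus (Fin 2) → ℝ} (ha : Continuous a) (ψ : ShearProfile)
    (hb : b = a ∘ shearMap 0 1 ψ) {w : ℤ → ℝ} {C : ℝ} (hw : ∀ m, |w m| ≤ C) :
    ∑' k : Fin 2 → ℤ, w (k 1) * ‖mFourierCoeff (fun x => (b x : ℂ)) k‖ ^ 2 =
      ∑' m : ℤ, ∑' n : ℤ, w n * ‖fourierCoeff (fun z : UnitAddCircle => twist ψ m z *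
        ∫ s : UnitAddCircle, (fourier (-m) s : ℂ) • ((a (![s, z] : UnitAddTorus (Fin 2)) : ℝ) : ℂ)) n‖ ^ 2 := by
  rw [tsum_verticalWeight_hstep_eq_fibre_chirp ha ψ hb hw]
  refine tsum_congr fun m => ?_
  have hac : Continuous (fun x : UnitAddTorus (Fin 2) => (a x : ℂ)) := Complex.continuous_ofReal.comp ha
  have h := tsum_slab_chirp_fibre_eq' hac (continuous_twist ψ m) m (fun k => w (k 1))
  simp only [Matrix.cons_val_one] at h
  exact h

end Summit.AnomalousDissipation.AnomalousDissipation.Theorems.SawtoothPulseCascade.K1Start
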